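import Literature.Topology.FourManifolds.RailHeart
import Literature.Topology.FourManifolds.SchoenfliesSphereThreeHolds
import HarnessLib

/-!
# Discharges of named facts of `SchubertRegular.lean`

`Literature/Topology/FourManifolds/SchubertRegularHolds.lean` — proofs-only sibling of
`SchubertRegular.lean` (no definitions, no named facts). Each theorem below closes a named
fact `X : Prop` of that file as `X_holds : X` by composing an ACCEPTED reduction theorem of
the tree with the ACCEPTED unconditional `_holds` discharges of all of its hypotheses; nothing
is re-proved and no statement is changed. Recorded by the librarian sweep g25 (2026-08-16,
pass 5c: facts dischargeable in one line from the tree's own lemmas), so that the facts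
census, `#h21_route_deps` and the cone guardrail see these facts as theorems.

Discharged here:

* `isIsotopic_holds` := `isIsotopic_of_ball` `schoenflies_exists_ball_holds`
  (`RailHeart.lean`).

## References

* [Cromwell2004] — see `lean/references.bib` and the docstring of the fact in `SchubertRegular.lean`.
* [Schubert1949] — see `lean/references.bib` and the docstring of the fact in `SchubertRegular.lean`.
-/

namespace Literature.Topology.FourManifolds.Knot.IsRegularConnectedSum

/-- **Discharge of the named fact `isIsotopic`** (`SchubertRegular.lean`): The connected sum is
well defined (Schubert 1949), printed form: any two *regular* connected sums of `K₁` and `K₂`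
are isotopic — `K₁ # K₂` does not depend on the split position, the splitting sphere, or the
(embedded, closed) rectangle. … — obtained as `isIsotopic_of_ball` applied to the tree's
unconditional discharge `schoenflies_exists_ball_holds` of its hypothesis (reduction in
`RailHeart.lean`).
[cite: Schubert1949, Satz 3]
[cite: Cromwell2004, §4.6 (PDF p. 69)] -/
theorem isIsotopic_holds :
    isIsotopic :=
  isIsotopic_of_ball
    Literature.Topology.FourManifolds.SphereEmbedding.schoenflies_exists_ball_holds

end Literature.Topology.FourManifolds.Knot.IsRegularConnectedSum
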